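import Literature.Topology.FourManifolds.SurgeryGluck
import Literature.Topology.FourManifolds.GluckTwistHomologyProofs
import Literature.Topology.FourManifolds.GluckTwistTubularUniqueness
import Literature.Topology.FourManifolds.GluckTwistUnknotProofs
import Literature.Topology.FourManifolds.SurgeryGluckPropertyR
import Literature.Topology.FourManifolds.KirbyMovesIsotopyProofs
import Literature.Topology.FourManifolds.KnotsIsotopyProofs
import Literature.Topology.FourManifolds.DehnSurgeryUnknotZeroProofs
import HarnessLib

/-!
# `Σ_K ≃ₜ S⁴` (spc4.S19, known part) from `spc4.S10` and Freedman's theorem; the unknotted case; Property R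

Proof file (sibling of `Literature.Topology.FourManifolds.SurgeryGluck`). Its first section
concerns the known part of `spc4.S19`, *every Gluck twist `Σ_K` of `S⁴` along a 2-knot `K` is
homeomorphic to `S⁴`* (H. Gluck, Trans. AMS 104 (1962), §17: `Σ_K` is a homotopy 4-sphere;
M. Freedman, J. Differential Geom. 17 (1982), Thm. 1.6: homotopy 4-spheres are homeomorphic to
`S⁴`), which is the prelude named fact
`Literature.Topology.FourManifolds.nonempty_homeomorph_sphere_of_isGluckTwist` (`GluckTwist.lean`).
(`SurgeryGluck.lean` formerly restated it, quantified over the 2-knot, as a second named fact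
`nonempty_homeomorph_sphere_four_of_isGluckTwist`; the two were equivalent knot by knot and the
restatement has been merged into the prelude fact (D-0026): the glue theorems `…_iff`,
`…_of_spc4`, `…_of_spc4_univ_zero` of this file went with it, their prelude forms being
`nonempty_homeomorph_sphere_of_isGluckTwist_of_spc4` (`_univ_zero`) of
`GluckTwistHomologyProofs.lean`.) The decomposition of the prelude fact
(`GluckTwistHomotopySphere.lean`, `GluckTwistProofs.lean`, `GluckTwistMeridian.lean`,
`GluckTwistHomologyProofs.lean`) proves every Gluck-specific input of Gluck's §17 argument —
compactness, simple connectivity (Kervaire's lemma by van Kampen), `H₂(Σ_K; ℤ) = 0`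
(Mayer–Vietoris) — and reduces it to two external named facts of `SPC4Wave0.lean`: the `π₁`/`H₂`
characterisation of homotopy 4-spheres `Literature.Topology.FourManifolds.nonempty_homotopyEquiv_sphere_four_iff`
(`spc4.S10`; Hurewicz, Whitehead, Poincaré duality) and Freedman's theorem
`Literature.Topology.FourManifolds.nonempty_homeomorph_sphere_four` (`spc4.S04`); later files reduce it to Freedman's
Cor. 1.2 alone (`GluckTwistFreedman.lean`, `GluckTwistFreedmanSmooth.lean`). This file records
the resulting status of the Gluck twist conjecture: it follows from the smooth 4-dimensional
Poincaré conjecture together with `spc4.S10` and Freedman's theorem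
(`GluckTwistConjecture.of_spc4`), and in fact from SPC4 and `spc4.S10` alone
(`GluckTwistConjecture.of_spc4'`).

No `nonempty_homeomorph_sphere_of_isGluckTwist_holds` is vendored: Freedman's theorem is not
available in the tree. No declaration in this file uses `sorry`; nothing is asserted.

**The unknotted case (appended section `Unknot`).** The second `spc4.S19` fact of
`SurgeryGluck.lean`, `Literature.Topology.FourManifolds.nonempty_diffeomorph_sphere_four_of_isGluckTwist_of_isUnknot`
(*a Gluck twist of `S⁴` along a 2-knot isotopic to the unknotted 2-sphere is diffeomorphic to
`S⁴`*; Gluck 1962, §17; Gompf–Stipsicz, Ex. 6.2.2 (a)), **is discharged** here: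
`nonempty_diffeomorph_sphere_four_of_isGluckTwist_of_isUnknot_holds`. Its in-file reduction
`nonempty_diffeomorph_sphere_four_of_isGluckTwist_of_isUnknot_of` takes as hypotheses the two
prelude Gluck facts of `GluckTwist.lean`, and both are now theorems of the tree —
`Literature.Topology.FourManifolds.nonempty_diffeomorph_of_isGluckTwist_holds` (`GluckTwistTubularUniqueness.lean`: the Gluck
twist is well defined on ambient isotopy classes, Gluck 1962 §8 with the uniqueness of tubular
neighbourhoods, Kosinski III.(3.5)) and `Literature.Topology.FourManifolds.isGluckTwist_sphere_unknotTwo_holds`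
(`GluckTwistUnknotProofs.lean`: `S⁴` is itself a Gluck twist of `S⁴` along `unknotTwo`, since
Gluck's twist `τ` extends over `S⁴ ∖ νU = B³ × S¹`; Gluck 1962 §17, Larson–Meier 2015 Lemma 4.6).

**Property R as an `iff` (appended section `PropertyRIff`, `spc4.S25`).** The last fact of
`SurgeryGluck.lean`, `Literature.Topology.FourManifolds.isIntegralSurgery_sphereTwo_prod_zero_iff`
(*`S² × S¹` is `0`-surgery on `K` iff `K` is the unknot*; Gabai, J. Differential Geom. 26 (1987),
Cor. 8.3 with Remark 8.5 for `→`; Rolfsen, *Knots and Links* (1976), §9.G Example 3 for `←`), is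
**assembled with proof** from its two printed ingredients, both named facts of the tree:
`isIntegralSurgery_sphereTwo_prod_zero_iff_of (hR) (h0)` with `hR : isUnknot_of_isIntegralSurgery_zero`
(Gabai's Property R theorem, `SurgeryGluck.lean`) and `h0 : isIntegralSurgery_unknot_zero`
(`0`-surgery on the unknot is `S² × S¹`, `DehnSurgery.lean`); the isotopy transport it needs —
surgery depends only on the knot type (`IsIntegralSurgery.of_isIsotopic_holds`,
`KirbyMovesIsotopyProofs.lean`) and symmetry of ambient isotopy
(`SphereEmbedding.IsIsotopic.symm_holds`, `KnotsIsotopyProofs.lean`) — is proved in the tree. The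
assembly is sharp: `isIntegralSurgery_sphereTwo_prod_zero_iff_iff` proves that the `iff` fact is
*equivalent* to the conjunction `isUnknot_of_isIntegralSurgery_zero ∧ isIntegralSurgery_unknot_zero`
(apply the `iff` to `unknot`), so `isIntegralSurgery_sphereTwo_prod_zero_iff_holds` is exactly as
far away as Gabai's theorem and the `S² × S¹` model. With the printed-proof reduction of
`SurgeryGluckPropertyR.lean` (`isUnknot_of_isIntegralSurgery_zero_of_gabai`) this gives
`isIntegralSurgery_sphereTwo_prod_zero_iff_of_gabai`: the `iff` from Gabai's Corollary 8.3 (genus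
clause, `Knot.hasSeifertSurfaceOfGenus_le_of_isIntegralSurgery_zero`), "genus `0` iff unknot"
(`Knot.genus_eq_zero_iff_isUnknot`) and `isIntegralSurgery_unknot_zero`. No
`isIntegralSurgery_sphereTwo_prod_zero_iff_holds` is vendored: Gabai's theorem (sutured manifold
hierarchies, taut foliations; Gabai 1987, Thm. 3.1 ⇒ Cor. 8.2 ⇒ Cor. 8.3) is not in the tree.
**Update.** The second ingredient is now a theorem of the tree,
`isIntegralSurgery_unknot_zero_holds` (`DehnSurgeryUnknotZeroProofs.lean`: the explicit tube around
the unknot, of framing `0`, and an explicit open gluing of `S³ ∖ U` and `D̊² × S¹` onto `S² × S¹`),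
so the direction `←` holds outright (`isIntegralSurgery_sphereTwo_prod_zero_of_isUnknot`) and the
`iff` fact is **equivalent to Gabai's Property R theorem alone**
(`isIntegralSurgery_sphereTwo_prod_zero_iff_iff_propertyR`,
`isIntegralSurgery_sphereTwo_prod_zero_iff_of_propertyR`); from the printed proof of the latter,
`isIntegralSurgery_sphereTwo_prod_zero_iff_of_gabai'` needs only Gabai's Corollary 8.3 (genus
clause) and "genus `0` iff unknot".

## References

* H. Gluck, *The embedding of two-spheres in the four-sphere*, Trans. Amer. Math. Soc. 104 (1962)
  308–333, §17 [GluckTAMS1962].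
* D. Gabai, *Foliations and the topology of 3-manifolds. III*, J. Differential Geom. 26 (1987)
  479–536, Cor. 8.3 (p. 525), Remark 8.5 (p. 526) [GabaiJDG1987].
* D. Rolfsen, *Knots and Links* (1976), §9.G Example 3 [RolfsenKnotsLinks1976].
* R. C. Kirby, *The Topology of 4-Manifolds*, LNM 1374 (1989), Ch. I §2 [Kirby1989].
* M. H. Freedman, *The topology of four-dimensional manifolds*, J. Differential Geom. 17 (1982)
  357–453, Thm. 1.6 [FreedmanJDG1982].
* M. H. Freedman, F. Quinn, *Topology of 4-Manifolds* (1990), Cor. 7.1B, §10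
  [FreedmanQuinnPMS1990].
* R. E. Gompf, A. I. Stipsicz, *4-Manifolds and Kirby Calculus*, GSM 20 (1999), §6.2,
  Ex. 6.2.2 (a) [GompfStipsiczGSM1999].
* K. Larson, J. Meier, *Fibered ribbon disks*, J. Knot Theory Ramifications 24 (2015) 1550066,
  Lemma 4.6 [LarsonMeier2015].
-/

open scoped Manifold ContDiff Topology

noncomputable section

namespace Literature.Topology.FourManifolds

universe u

/-- Local notation: `𝔼 n` is the model Euclidean space `EuclideanSpace ℝ (Fin n)`. -/
local notation "𝔼 " n:arg => EuclideanSpace ℝ (Fin n)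

/-- Local notation: `𝕊 n` is the unit sphere in `EuclideanSpace ℝ (Fin (n + 1))`. -/
local notation "𝕊 " n:arg => (Metric.sphere (0 : EuclideanSpace ℝ (Fin (n + 1))) 1)

/-- **A Gluck twist is a homotopy 4-sphere, from `spc4.S10` alone** (SPC4 form of
`Literature.Topology.FourManifolds.nonempty_homotopyEquiv_sphere_of_isGluckTwist_of_spc4`; Gluck 1962, §17).
[cite: GluckTAMS1962, §17] -/
theorem nonempty_homotopyEquiv_sphere_four_of_isGluckTwist_of_spc4
    (hS10 : nonempty_homotopyEquiv_sphere_four_iff.{u}) {K : TwoKnot} {X : Type u}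
    [TopologicalSpace X] [T2Space X] [SecondCountableTopology X] [ChartedSpace (𝔼 4) X]
    [IsManifold (𝓡 4) ∞ X] (hX : IsGluckTwist (𝓡 4) X K) :
    Nonempty (ContinuousMap.HomotopyEquiv X (𝕊 4)) :=
  Literature.Topology.FourManifolds.nonempty_homotopyEquiv_sphere_of_isGluckTwist_of_spc4 hS10 hX

/-- **Status of the Gluck twist conjecture.** It follows from the smooth 4-dimensional Poincaré
conjecture (in the form `∀ M, ContinuousMap.HomotopyEquiv.NonemptyDiffeomorphSphere M 4`, the
body of `Literature.SPC4.SmoothPoincareConjectureFour`), the `π₁`/`H₂` characterisation of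
homotopy 4-spheres `spc4.S10` and Freedman's theorem `spc4.S04`: every Gluck-specific input (compactness, `π₁ = 1`,
`H₂ = 0`; Gluck 1962, §17) is proved in the tree, so a Gluck twist `X` along `K` is homeomorphic
to `S⁴` given `spc4.S10` and `spc4.S04`
(`Literature.Topology.FourManifolds.nonempty_homeomorph_sphere_of_isGluckTwist_of_spc4`,
`GluckTwistHomologyProofs.lean`); a homeomorphism is a homotopy equivalence
(`Homeomorph.toHomotopyEquiv`), and the smooth Poincaré hypothesis applies (Gordon–Kirby 1984,
p. 37). In fact Freedman's theorem is not needed for this implication: a Gluck twist is a homotopy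
4-sphere by `spc4.S10` alone, see `GluckTwistConjecture.of_spc4'`.
[cite: GluckTAMS1962, §17 (the question)] -/
theorem GluckTwistConjecture.of_spc4
    (hSPC4 : ∀ (M : Type u) [TopologicalSpace M] [T2Space M] [SecondCountableTopology M],
      ContinuousMap.HomotopyEquiv.NonemptyDiffeomorphSphere M 4)
    (hS10 : nonempty_homotopyEquiv_sphere_four_iff.{u})
    (hF : nonempty_homeomorph_sphere_four.{u}) : GluckTwistConjecture.{u} := by
  intro K X _ _ _ _ _ hX
  obtain ⟨e⟩ :=
    Literature.Topology.FourManifolds.nonempty_homeomorph_sphere_of_isGluckTwist_of_spc4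
      (K := K) hS10 hF hX
  exact hSPC4 X ‹_› ‹_› e.toHomotopyEquiv

/-- **The Gluck twist conjecture from SPC4 and `spc4.S10`**, without Freedman's theorem: a Gluck
twist is a homotopy 4-sphere (`nonempty_homotopyEquiv_sphere_four_of_isGluckTwist_of_spc4`), to
which the smooth Poincaré hypothesis applies directly. [cite: GluckTAMS1962, §17 (the question)] -/
theorem GluckTwistConjecture.of_spc4'
    (hSPC4 : ∀ (M : Type u) [TopologicalSpace M] [T2Space M] [SecondCountableTopology M],
      ContinuousMap.HomotopyEquiv.NonemptyDiffeomorphSphere M 4)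
    (hS10 : nonempty_homotopyEquiv_sphere_four_iff.{u}) : GluckTwistConjecture.{u} := by
  intro K X _ _ _ _ _ hX
  obtain ⟨e⟩ := nonempty_homotopyEquiv_sphere_four_of_isGluckTwist_of_spc4 hS10 hX
  exact hSPC4 X ‹_› ‹_› e

/-! ### spc4.S19, unknotted case: discharge of
`nonempty_diffeomorph_sphere_four_of_isGluckTwist_of_isUnknot` (Gluck 1962, §§8, 17)

Gluck, Trans. AMS 104 (1962), §17 (and Gompf–Stipsicz, Ex. 6.2.2 (a); Larson–Meier, *Fibered
ribbon disks* (2015), Lemma 4.6: "Let `U` be the unknotted 2-sphere in `S⁴`. Performing a Gluck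
twist on `U` gives back `(S⁴, U)`", because `S⁴ ∖ νU = B³ × S¹` and the twist
`ρ (x, θ) = (rot_θ x, θ)` extends over `B³ × S¹`). With the relational definition
`Literature.Topology.FourManifolds.IsGluckTwist` this is the conjunction of two theorems of the tree: `S⁴` *is a* Gluck
twist of `S⁴` along `unknotTwo` (`isGluckTwist_sphere_unknotTwo_holds`), and any two Gluck twists
along ambient isotopic 2-knots are diffeomorphic (`nonempty_diffeomorph_of_isGluckTwist_holds`). The
fact is stated under the `Prop`-valued instance hypothesis `[SphereEmbedding.SmoothnessFacts]` of
`Knots.lean` (needed to form `unknotTwo`); the discharge holds for every such instance (one is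
`Literature.Topology.FourManifolds.SphereEmbedding.smoothnessFacts`, `KnotsProofs.lean`) and at every universe `u`. -/

section Unknot

variable [SphereEmbedding.SmoothnessFacts]

/-- **The Gluck twist conjecture holds for the unknotted 2-sphere** — discharge of the named fact
`Literature.Topology.FourManifolds.nonempty_diffeomorph_sphere_four_of_isGluckTwist_of_isUnknot` (`SurgeryGluck.lean`): every
smooth 4-manifold `X` (atlas on `ℝ⁴`) which is a Gluck twist of `S⁴` along a 2-knot `K` isotopic
to the unknotted 2-sphere `unknotTwo` is diffeomorphic to `𝕊 4`. Proof: `𝕊 4` is a Gluck twist of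
`𝕊 4` along `unknotTwo` (`Literature.Topology.FourManifolds.isGluckTwist_sphere_unknotTwo_holds`; Gluck 1962, §17: the twist
extends over `S⁴ ∖ νU = B³ × S¹`), and Gluck twists along isotopic 2-knots, for arbitrary tubular
neighbourhoods, are diffeomorphic (`Literature.Topology.FourManifolds.nonempty_diffeomorph_of_isGluckTwist_holds`; Gluck 1962,
§8); the two are assembled by the reduction
`nonempty_diffeomorph_sphere_four_of_isGluckTwist_of_isUnknot_of` of `SurgeryGluck.lean`.
[cite: GluckTAMS1962, §§8, 17] [cite: GompfStipsiczGSM1999, Ex. 6.2.2(a)]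
[cite: LarsonMeier2015, Lemma 4.6] -/
theorem nonempty_diffeomorph_sphere_four_of_isGluckTwist_of_isUnknot_holds :
    nonempty_diffeomorph_sphere_four_of_isGluckTwist_of_isUnknot.{u} :=
  nonempty_diffeomorph_sphere_four_of_isGluckTwist_of_isUnknot_of
    nonempty_diffeomorph_of_isGluckTwist_holds isGluckTwist_sphere_unknotTwo_holds

/-- Pointwise form of `nonempty_diffeomorph_sphere_four_of_isGluckTwist_of_isUnknot_holds`: a Gluck
twist of `S⁴` along an unknotted 2-knot is diffeomorphic to `𝕊 4` (Gluck 1962, §17;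
Gompf–Stipsicz, Ex. 6.2.2 (a)). [cite: GluckTAMS1962, §17] [cite: GompfStipsiczGSM1999, Ex. 6.2.2(a)] -/
theorem nonempty_diffeomorph_sphere_four_of_isGluckTwist_of_isUnknot' {K : TwoKnot} {X : Type u}
    [TopologicalSpace X] [ChartedSpace (𝔼 4) X] [IsManifold (𝓡 4) ∞ X]
    (h : IsGluckTwist (𝓡 4) X K) (hK : K.IsUnknot) : Nonempty (X ≃ₘ⟮𝓡 4, 𝓡 4⟯ (𝕊 4)) :=
  nonempty_diffeomorph_sphere_four_of_isGluckTwist_of_isUnknot_holds h hK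

/-- In particular every Gluck twist of `S⁴` along the unknotted 2-sphere `unknotTwo` itself — for
any tubular neighbourhood and either fibre orientation — is diffeomorphic to `𝕊 4` (Gluck 1962,
§17; Gompf–Stipsicz, Ex. 6.2.2 (a)). [cite: GluckTAMS1962, §17] [cite: GompfStipsiczGSM1999, Ex. 6.2.2(a)] -/
theorem nonempty_diffeomorph_sphere_four_of_isGluckTwist_unknotTwo {X : Type u}
    [TopologicalSpace X] [ChartedSpace (𝔼 4) X] [IsManifold (𝓡 4) ∞ X]
    (h : IsGluckTwist (𝓡 4) X unknotTwo) : Nonempty (X ≃ₘ⟮𝓡 4, 𝓡 4⟯ (𝕊 4)) :=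
  nonempty_diffeomorph_sphere_four_of_isGluckTwist_of_isUnknot_holds h isUnknot_unknotTwo

/-- **Status of the Gluck twist conjecture, unknotted case.** `GluckTwistConjecture` restricted to
2-knots isotopic to `unknotTwo` holds outright (no SPC4, `spc4.S10` or Freedman hypothesis), by
`nonempty_diffeomorph_sphere_four_of_isGluckTwist_of_isUnknot_holds`. [cite: GluckTAMS1962, §17] -/
theorem GluckTwistConjecture.of_isUnknot (K : TwoKnot) (hK : K.IsUnknot) (X : Type u)
    [TopologicalSpace X] [T2Space X] [SecondCountableTopology X] [ChartedSpace (𝔼 4) X]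
    [IsManifold (𝓡 4) ∞ X] (hX : IsGluckTwist (𝓡 4) X K) : Nonempty (X ≃ₘ⟮𝓡 4, 𝓡 4⟯ (𝕊 4)) :=
  nonempty_diffeomorph_sphere_four_of_isGluckTwist_of_isUnknot_holds hX hK

end Unknot

/-! ### spc4.S25: Property R as an `iff`, assembled from its printed ingredients

Gabai, *Foliations and the topology of 3-manifolds. III*, J. Differential Geom. 26 (1987): Cor. 8.3
(p. 525: "If `M` is obtained by performing zero frame surgery on a knot in `S³`, then `M` is prime
and genus `k = min{genus S | S` is a nonseparating oriented embedded surface in `M}`") and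
Remark 8.5 (p. 526: "The Property R conjecture asserts that zero frame surgery on a nontrivial knot
`k` in `S³` does not yield `S² × S¹`. … Corollary 8.3 gives positive proofs of these
conjectures."), give the direction `→` of `isIntegralSurgery_sphereTwo_prod_zero_iff`, which is
verbatim the named fact `isUnknot_of_isIntegralSurgery_zero`. The direction `←` is Rolfsen (1976),
§9.G Example 3 (`0`-surgery on the unknot is `S² × S¹`: the named fact
`isIntegralSurgery_unknot_zero` of `DehnSurgery.lean`) transported along the isotopy `unknot ∼ K`
(surgery depends only on the knot type, `IsIntegralSurgery.of_isIsotopic_holds`; symmetry of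
isotopy, `SphereEmbedding.IsIsotopic.symm_holds` — both theorems of the tree). -/

section PropertyRIff

variable [SphereEmbedding.SmoothnessFacts]

/-- **Property R as an `iff`, from its two printed ingredients** (proved assembly of
`isIntegralSurgery_sphereTwo_prod_zero_iff`): Gabai's Property R theorem
`hR : isUnknot_of_isIntegralSurgery_zero` (Gabai (1987), Cor. 8.3 with Remark 8.5) is the direction
`→`; the direction `←` is `h0 : isIntegralSurgery_unknot_zero` (`S² × S¹` is `0`-surgery on
`unknot`; Rolfsen (1976), §9.G Example 3) transported from `unknot` to the isotopic knot `K` by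
`IsIntegralSurgery.of_isIsotopic_holds` (Rolfsen §9.F) along the reversed isotopy
`SphereEmbedding.IsIsotopic.symm_holds hK : unknot.IsIsotopic K`. This is the interim proof
preserved in the comment after the fact in `SurgeryGluck.lean`, with its two then-sorried
ingredients as hypotheses and the two isotopy facts now fed by their discharges.
[cite: GabaiJDG1987, Cor. 8.3 and Remark 8.5] [cite: RolfsenKnotsLinks1976, §9.G Example 3] -/
theorem isIntegralSurgery_sphereTwo_prod_zero_iff_of (hR : isUnknot_of_isIntegralSurgery_zero)
    (h0 : isIntegralSurgery_unknot_zero) : isIntegralSurgery_sphereTwo_prod_zero_iff := fun K ↦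
  ⟨hR K, fun hK ↦
    IsIntegralSurgery.of_isIsotopic_holds h0 (SphereEmbedding.IsIsotopic.symm_holds hK)⟩

/-- Conversely the `iff` fact contains both ingredients: its direction `→` is Property R
(`isUnknot_of_isIntegralSurgery_zero`), and at `K = unknot` (which is an unknot,
`isUnknot_unknot`) its direction `←` is `isIntegralSurgery_unknot_zero`. [folklore] -/
theorem isIntegralSurgery_sphereTwo_prod_zero_iff.ingredients
    (h : isIntegralSurgery_sphereTwo_prod_zero_iff) :
    isUnknot_of_isIntegralSurgery_zero ∧ isIntegralSurgery_unknot_zero :=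
  ⟨fun K ↦ (h K).1, (h unknot).2 isUnknot_unknot⟩

/-- **What `isIntegralSurgery_sphereTwo_prod_zero_iff_holds` amounts to.** The `iff` fact is
equivalent to the conjunction of Gabai's Property R theorem `isUnknot_of_isIntegralSurgery_zero`
(Gabai (1987), Cor. 8.3, Remark 8.5) and the model computation `isIntegralSurgery_unknot_zero`
(Rolfsen (1976), §9.G Example 3); the isotopy transport in between is proved.
[cite: GabaiJDG1987, Cor. 8.3 and Remark 8.5] [cite: RolfsenKnotsLinks1976, §9.G Example 3] -/
theorem isIntegralSurgery_sphereTwo_prod_zero_iff_iff :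
    isIntegralSurgery_sphereTwo_prod_zero_iff ↔
      isUnknot_of_isIntegralSurgery_zero ∧ isIntegralSurgery_unknot_zero :=
  ⟨isIntegralSurgery_sphereTwo_prod_zero_iff.ingredients,
    fun h ↦ isIntegralSurgery_sphereTwo_prod_zero_iff_of h.1 h.2⟩

/-- Pointwise form for users holding the two facts: `S² × S¹` is `0`-surgery on `K` iff `K` is
the unknot. [cite: GabaiJDG1987, Cor. 8.3 and Remark 8.5] -/
theorem isIntegralSurgery_sphereTwo_prod_zero_iff_of' (hR : isUnknot_of_isIntegralSurgery_zero)
    (h0 : isIntegralSurgery_unknot_zero) (K : Knot) :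
    IsIntegralSurgery ((𝓡 2).prod (𝓡 1)) ((𝕊 2) × (𝕊 1)) K 0 ↔ K.IsUnknot :=
  isIntegralSurgery_sphereTwo_prod_zero_iff_of hR h0 K

/-- **The `iff` from the printed proof of Property R.** Gabai's Corollary 8.3 (genus clause,
`Knot.hasSeifertSurfaceOfGenus_le_of_isIntegralSurgery_zero`: a `0`-surgery `M` on `K` containing
a nonseparating closed orientable surface of genus `g` forces a Seifert surface of genus `≤ g`),
"genus `0` iff unknot" (`Knot.genus_eq_zero_iff_isUnknot`; Papakyriakopoulos 1957, Rolfsen §4.B)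
— which together give Property R by the deduction of Gabai's Remark 8.5, `S² × {p} ⊆ S² × S¹`
being a nonseparating sphere (`isUnknot_of_isIntegralSurgery_zero_of_gabai`,
`SurgeryGluckPropertyR.lean`) — and the model computation `isIntegralSurgery_unknot_zero`
(Rolfsen (1976), §9.G Example 3) imply `isIntegralSurgery_sphereTwo_prod_zero_iff`.
[cite: GabaiJDG1987, Cor. 8.3 and Remark 8.5] [cite: RolfsenKnotsLinks1976, §9.G Example 3] -/
theorem isIntegralSurgery_sphereTwo_prod_zero_iff_of_gabai
    (h83 : Knot.hasSeifertSurfaceOfGenus_le_of_isIntegralSurgery_zero.{0})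
    (hD : Knot.genus_eq_zero_iff_isUnknot) (h0 : isIntegralSurgery_unknot_zero) :
    isIntegralSurgery_sphereTwo_prod_zero_iff :=
  isIntegralSurgery_sphereTwo_prod_zero_iff_of (isUnknot_of_isIntegralSurgery_zero_of_gabai h83 hD) h0

/-! #### With `isIntegralSurgery_unknot_zero` discharged

`isIntegralSurgery_unknot_zero_holds` (`DehnSurgeryUnknotZeroProofs.lean`; Rolfsen (1976), §9.G
Example 3; Kirby, *The Topology of 4-Manifolds* (1989), Ch. I §2) feeds the hypothesis `h0` of the
assembly: the direction `←` of the `iff` holds unconditionally and what remains of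
`isIntegralSurgery_sphereTwo_prod_zero_iff_holds` is exactly Gabai's Property R theorem. -/

/-- **`S² × S¹` is `0`-surgery on every unknotted knot** (the direction `←` of
`isIntegralSurgery_sphereTwo_prod_zero_iff`, unconditionally): `0`-surgery on `unknot` is `S² × S¹`
(`isIntegralSurgery_unknot_zero_holds`; Rolfsen (1976), §9.G Example 3), transported to the
isotopic knot `K` (`IsIntegralSurgery.of_isIsotopic_holds`, `SphereEmbedding.IsIsotopic.symm_holds`).
[cite: RolfsenKnotsLinks1976, §9.G Example 3] -/
theorem isIntegralSurgery_sphereTwo_prod_zero_of_isUnknot {K : Knot} (hK : K.IsUnknot) :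
    IsIntegralSurgery ((𝓡 2).prod (𝓡 1)) ((𝕊 2) × (𝕊 1)) K 0 :=
  IsIntegralSurgery.of_isIsotopic_holds isIntegralSurgery_unknot_zero_holds
    (SphereEmbedding.IsIsotopic.symm_holds hK)

/-- **Property R is not a vacuous statement**: its hypothesis is satisfiable — `S² × S¹` *is*
`0`-surgery on some knot, namely the unknot (`isIntegralSurgery_unknot_zero_holds`; Rolfsen (1976),
§9.G Example 3). [cite: RolfsenKnotsLinks1976, §9.G Example 3] -/
theorem exists_isIntegralSurgery_sphereTwo_prod_zero :
    ∃ K : Knot, IsIntegralSurgery ((𝓡 2).prod (𝓡 1)) ((𝕊 2) × (𝕊 1)) K 0 :=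
  ⟨unknot, isIntegralSurgery_unknot_zero_holds⟩

/-- **The `iff` from Gabai's Property R theorem alone**: `isUnknot_of_isIntegralSurgery_zero`
(Gabai (1987), Cor. 8.3 with Remark 8.5) implies `isIntegralSurgery_sphereTwo_prod_zero_iff`, the
other ingredient `isIntegralSurgery_unknot_zero` being a theorem.
[cite: GabaiJDG1987, Cor. 8.3 and Remark 8.5] -/
theorem isIntegralSurgery_sphereTwo_prod_zero_iff_of_propertyR
    (hR : isUnknot_of_isIntegralSurgery_zero) : isIntegralSurgery_sphereTwo_prod_zero_iff :=
  isIntegralSurgery_sphereTwo_prod_zero_iff_of hR isIntegralSurgery_unknot_zero_holds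

/-- **Status of `isIntegralSurgery_sphereTwo_prod_zero_iff`**: the `iff` fact is *equivalent* to
Gabai's Property R theorem `isUnknot_of_isIntegralSurgery_zero` (Gabai (1987), Cor. 8.3,
Remark 8.5); `isIntegralSurgery_sphereTwo_prod_zero_iff_holds` is exactly as far away as
`isUnknot_of_isIntegralSurgery_zero_holds`. [cite: GabaiJDG1987, Cor. 8.3 and Remark 8.5] -/
theorem isIntegralSurgery_sphereTwo_prod_zero_iff_iff_propertyR :
    isIntegralSurgery_sphereTwo_prod_zero_iff ↔ isUnknot_of_isIntegralSurgery_zero :=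
  ⟨fun h ↦ h.ingredients.1, isIntegralSurgery_sphereTwo_prod_zero_iff_of_propertyR⟩

/-- **The `iff` from the printed proof of Property R, two named facts down**: Gabai's Corollary 8.3
(genus clause, `Knot.hasSeifertSurfaceOfGenus_le_of_isIntegralSurgery_zero`) and "genus `0` iff
unknot" (`Knot.genus_eq_zero_iff_isUnknot`; Papakyriakopoulos 1957, Rolfsen §4.B) imply
`isIntegralSurgery_sphereTwo_prod_zero_iff` (`isIntegralSurgery_sphereTwo_prod_zero_iff_of_gabai`
with `h0 := isIntegralSurgery_unknot_zero_holds`). [cite: GabaiJDG1987, Cor. 8.3 and Remark 8.5] -/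
theorem isIntegralSurgery_sphereTwo_prod_zero_iff_of_gabai'
    (h83 : Knot.hasSeifertSurfaceOfGenus_le_of_isIntegralSurgery_zero.{0})
    (hD : Knot.genus_eq_zero_iff_isUnknot) : isIntegralSurgery_sphereTwo_prod_zero_iff :=
  isIntegralSurgery_sphereTwo_prod_zero_iff_of_gabai h83 hD isIntegralSurgery_unknot_zero_holds

end PropertyRIff

end Literature.Topology.FourManifolds

end
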